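import Summits.Schanuel.Schanuel.Theorems.RootDecomp1KDarkLogSq05
import Summits.Schanuel.Schanuel.Theorems.RootDecomp1KTHLayerCell05

/-!
# RootDecomp1KDarkLogSq — lens 6, generation 19 «DARK LOG-SQUARE KERNEL ⇒ THE POSITIVE-ORDER LAYER F₊ OF 33364 IS CLOSED AT n = 2» (K-R27 (F₊) lane; input NW96 Thm 1 BY NAME) — continuation (RootDecomp1KDarkLogSq06): §P the HOME probes as theorems (PORT per VERDICT L1938: `n = 2` slices `Item33364Two`/`PosLayerTwo`/`THLayerTwo`/`UnderTHTwo`, LIVE read-backs P0–P7 incl. P2′ `rfl` against the live 33364) — the ONLY part importing the route files (via tree `RootDecomp1KTHLayerCell05`)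

(lens-6 g19 `DarkLogSq.lean` [HOME/decomp-schanuel-lens-6/g19/ sha256 81ff816b…, 1170 l; NODE L1934 / REQUEST L1935; critic VERDICT L1938 (K-R27 (F₊) cell credit, port GO)]; port by census-1 gen 17 as
`RootDecomp1KDarkLogSq01`–`06` — see the PORT NOTE of part 01; `--supports stmt-Schanuel-33364`; rung 0.)
-/

noncomputable section

open Complex IntermediateField Filter Polynomial
open Literature.NumberTheory.Transcendental (NesterenkoWaldschmidt1996_thm_1)
open Summit.Schanuel.Schanuel.Theorems.RootDecomp1KHyper
open Summit.Schanuel.Schanuel.Theorems.RootDecomp1KHyper.HyperCell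
open Summit.Schanuel.Schanuel.Theorems.RootDecomp1KGeneric (LiouvilleOrder LogSqLiouville sb_two_of_ordRatio
  sb_two_of_lowOrderResidual)
open Summit.Schanuel.Schanuel.Theorems.RootDecomp1KRelLiouvilleCell

namespace Summit.Schanuel.Schanuel.Theorems.RootDecomp1KDarkLogSq

/-! ## §P. PROBES against the LIVE route file `Theses/RootDecomp1K.lean` (read-backs by positional application / `Iff.rfl`;
no new mathematics).  `…Two` = the `n = 2` slice of the corresponding TREE text, written out. -/
section Probe
open Literature.Barriers.Schanuel (TechnicalHypothesis)
open Summit.Schanuel.Schanuel.Theorems.RootDecomp1KTHLayer (Item33364 THLayer PosLayer UnderTH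
  finiteOrderLiouvilleSchanuel_iff_item33364 schanuelUnderTH_iff_underTH)

/-- `n = 2` slice of `Item33364` (= LIVE 33364). -/
def Item33364Two : Prop :=
  ∀ (z : Fin 2 → ℂ), LinearIndependent ℚ z →
    (∀ ω : ℕ, ∃ h : Fin 2 → ℤ, h ≠ 0 ∧ ‖∑ i, (h i : ℂ) * z i‖ < 1 / (1 + ∑ i, (|h i| : ℝ)) ^ ω) →
    (¬ ∀ m : ℕ, ∃ h : Fin 2 → ℤ, h ≠ 0 ∧
        ‖∑ i, (h i : ℂ) * z i‖ < Real.exp (-((1 + ∑ i, (|h i| : ℝ)) ^ m))) →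
    ((2 : ℕ) : Cardinal) ≤ Algebra.trdeg ℚ
      ↥(IntermediateField.adjoin ℚ (Set.range z ∪ Set.range (Complex.exp ∘ z)))

/-- `n = 2` slice of `PosLayer` (F₊). -/
def PosLayerTwo : Prop :=
  ∀ (z : Fin 2 → ℂ), LinearIndependent ℚ z →
    (∀ ω : ℕ, ∃ h : Fin 2 → ℤ, h ≠ 0 ∧ ‖∑ i, (h i : ℂ) * z i‖ < 1 / (1 + ∑ i, (|h i| : ℝ)) ^ ω) →
    (¬ ∀ m : ℕ, ∃ h : Fin 2 → ℤ, h ≠ 0 ∧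
        ‖∑ i, (h i : ℂ) * z i‖ < Real.exp (-((1 + ∑ i, (|h i| : ℝ)) ^ m))) →
    ¬ TechnicalHypothesis z →
    ((2 : ℕ) : Cardinal) ≤ Algebra.trdeg ℚ
      ↥(IntermediateField.adjoin ℚ (Set.range z ∪ Set.range (Complex.exp ∘ z)))

/-- `n = 2` slice of `THLayer` (F₀). -/
def THLayerTwo : Prop :=
  ∀ (z : Fin 2 → ℂ), LinearIndependent ℚ z →
    (∀ ω : ℕ, ∃ h : Fin 2 → ℤ, h ≠ 0 ∧ ‖∑ i, (h i : ℂ) * z i‖ < 1 / (1 + ∑ i, (|h i| : ℝ)) ^ ω) →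
    (¬ ∀ m : ℕ, ∃ h : Fin 2 → ℤ, h ≠ 0 ∧
        ‖∑ i, (h i : ℂ) * z i‖ < Real.exp (-((1 + ∑ i, (|h i| : ℝ)) ^ m))) →
    TechnicalHypothesis z →
    ((2 : ℕ) : Cardinal) ≤ Algebra.trdeg ℚ
      ↥(IntermediateField.adjoin ℚ (Set.range z ∪ Set.range (Complex.exp ∘ z)))

/-- `n = 2` slice of `UnderTH` (= LIVE 3816, Waldschmidt Conj. 2.3). -/
def UnderTHTwo : Prop :=
  ∀ (z : Fin 2 → ℂ), LinearIndependent ℚ z → TechnicalHypothesis z →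
    ((2 : ℕ) : Cardinal) ≤ Algebra.trdeg ℚ
      ↥(IntermediateField.adjoin ℚ (Set.range z ∪ Set.range (Complex.exp ∘ z)))

/-- P1 — the slices ARE the `n = 2` instances of the TREE texts (positional application, no rewriting). -/
theorem probe_P1_item33364_two (h : Summit.Schanuel.Schanuel.Theses.RootDecomp1K.FiniteOrderLiouvilleSchanuel) : Item33364Two := h 2
/-- Probe read-back (§P; see the preceding docstring group). -/
theorem probe_P1_posLayer_two (h : PosLayer) : PosLayerTwo := h 2
/-- Probe read-back (§P; see the preceding docstring group). -/
theorem probe_P1_thLayer_two (h : THLayer) : THLayerTwo := h 2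
/-- Probe read-back (§P; see the preceding docstring group). -/
theorem probe_P1_underTH_two (h : UnderTH) : UnderTHTwo := h 2
/-- Probe read-back (§P; see the preceding docstring group). -/
theorem probe_P1_schanuelUnderTH_two (h : Summit.Schanuel.Schanuel.Theses.DiophantineCore.SchanuelUnderTH) : UnderTHTwo :=
  (schanuelUnderTH_iff_underTH.mp h) 2
/-- P2 — HEADLINE READ-BACK: `posLayer_two_of_NW hNW : PosLayerTwo` — the F₊ layer of the LIVE 33364 at `n = 2` is DECIDED
mod NW96 Thm 1. -/
theorem probe_P2_posLayer_two_of_NW (hNW : NesterenkoWaldschmidt1996_thm_1) : PosLayerTwo := posLayer_two_of_NW hNW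
/-- P2′ — THE DECIDED PART OF LEVEL 2 IN THE ITEM'S OWN WORDS (critic frame G19 (3)): the LIVE decl at `n = 2` and the class theorem
`item33364_two_logHyperClass hNW` accept THE SAME binders `z hz hL hH` (positional read-back: the binder types of `hz hL hH` are fixed by the
LIVE decl and must agree with the class theorem's, else this does not elaborate); the class theorem needs in addition only the class
membership `∃ ρ, LogHyperLiouville ρ ∧ z 1 = ρ·z 0`. -/
theorem probe_P2prime_live_eq_classTheorem (hNW : NesterenkoWaldschmidt1996_thm_1)
    (h33364 : Summit.Schanuel.Schanuel.Theses.RootDecomp1K.FiniteOrderLiouvilleSchanuel) (z : Fin 2 → ℂ)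
    (hcls : ∃ ρ : ℝ, LogHyperLiouville ρ ∧ z 1 = (ρ : ℂ) * z 0) :
    ∀ hz hL hH, h33364 2 z hz hL hH = item33364_two_logHyperClass hNW z hz hL hH hcls :=
  fun _ _ _ => rfl
/-- Probe read-back (§P; see the preceding docstring group). -/
theorem probe_P2prime_class_statement (hNW : NesterenkoWaldschmidt1996_thm_1) :
    ∀ (z : Fin 2 → ℂ), LinearIndependent ℚ z →
      (∀ ω : ℕ, ∃ h : Fin 2 → ℤ, h ≠ 0 ∧ ‖∑ i, (h i : ℂ) * z i‖ < 1 / (1 + ∑ i, (|h i| : ℝ)) ^ ω) →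
      (¬ ∀ m : ℕ, ∃ h : Fin 2 → ℤ, h ≠ 0 ∧
          ‖∑ i, (h i : ℂ) * z i‖ < Real.exp (-((1 + ∑ i, (|h i| : ℝ)) ^ m))) →
      (∃ ρ : ℝ, LogHyperLiouville ρ ∧ z 1 = (ρ : ℂ) * z 0) →
      ((2 : ℕ) : Cardinal) ≤ Algebra.trdeg ℚ
        ↥(IntermediateField.adjoin ℚ (Set.range z ∪ Set.range (Complex.exp ∘ z))) :=
  item33364_two_logHyperClass hNW
/-- P2″ — and the whole layer F₊ lies in that class (hypothesis-free): a pair violating (T.H.) HAS a log-hyper-Liouville ratio. -/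
theorem probe_P2dprime_layer_in_class {z : Fin 2 → ℂ} (hz : LinearIndependent ℚ z)
    (hL : ∀ ω : ℕ, ∃ h : Fin 2 → ℤ, h ≠ 0 ∧ ‖∑ i, (h i : ℂ) * z i‖ < 1 / (1 + ∑ i, (|h i| : ℝ)) ^ ω)
    (hnTH : ¬ TechnicalHypothesis z) : ∃ ρ : ℝ, LogHyperLiouville ρ ∧ z 1 = (ρ : ℂ) * z 0 :=
  exists_logHyperLiouville_ratio_of_not_technicalHypothesis hz hL hnTH
/-- P3 — `33364|₂ ⟸ F₀|₂` and `33364|₂ ⟸ 3816|₂` (mod NW96 Thm 1), against the typed slices and against the LIVE 3816 decl. -/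
theorem probe_P3_of_thLayer_two (hNW : NesterenkoWaldschmidt1996_thm_1) (hF₀ : THLayerTwo) : Item33364Two := item33364_two_of_thLayer_two hNW hF₀
/-- Probe read-back (§P; see the preceding docstring group). -/
theorem probe_P3_of_underTH_two (hNW : NesterenkoWaldschmidt1996_thm_1) (hU : UnderTHTwo) : Item33364Two := item33364_two_of_underTH_two hNW hU
/-- Probe read-back (§P; see the preceding docstring group). -/
theorem probe_P3_of_schanuelUnderTH (hNW : NesterenkoWaldschmidt1996_thm_1) (h3816 : Summit.Schanuel.Schanuel.Theses.DiophantineCore.SchanuelUnderTH) :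
    Item33364Two :=
  item33364_two_of_underTH_two hNW ((schanuelUnderTH_iff_underTH.mp h3816) 2)
/-- P4 — MEMBERS ARE INSTANCES OF THE LIVE ITEM: the live 33364, applied at `z_A` / `z_B` with the hypothesis-free certificates,
typechecks and yields exactly `SB 2 zA` / `SB 2 zB` — the statements `sb_zA` / `sb_zB` prove (mod NW96 Thm 1). -/
theorem probe_P4_live_at_zA (h : Summit.Schanuel.Schanuel.Theses.RootDecomp1K.FiniteOrderLiouvilleSchanuel) : SB 2 zA :=
  h 2 zA linearIndependent_zA linLiouville_zA not_hyperLinLiouville_zA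
/-- Probe read-back (§P; see the preceding docstring group). -/
theorem probe_P4_live_at_zB (h : Summit.Schanuel.Schanuel.Theses.RootDecomp1K.FiniteOrderLiouvilleSchanuel) : SB 2 zB :=
  h 2 zB zB_in_scope_posLayer.1 zB_in_scope_posLayer.2.1 zB_in_scope_posLayer.2.2.1
/-- Probe read-back (§P; see the preceding docstring group). -/
theorem probe_P4_members (hNW : NesterenkoWaldschmidt1996_thm_1) : SB 2 zA ∧ SB 2 zB := ⟨sb_zA hNW, sb_zB hNW⟩
/-- P4′ — `z_B` is an instance of the F₊ layer (LIVE `PosLayer` applies to it), `z_A`'s (T.H.)-status is NOT certified. -/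
theorem probe_P4prime_posLayer_at_zB (h : PosLayer) : SB 2 zB :=
  h 2 zB zB_in_scope_posLayer.1 zB_in_scope_posLayer.2.1 zB_in_scope_posLayer.2.2.1 zB_in_scope_posLayer.2.2.2
/-- P5 — RESIDUAL COMPARISON: the TREE residual hypothesis of record (`sb_two_of_lowOrderResidual`: ratios of NO exponential
order 49) IMPLIES the new residual hypothesis (`sb_two_of_logFloorResidual`: ratios NOT log-hyper-Liouville) — new ⊆ old. -/
theorem probe_P5_residual_comparison (hres : ∀ (t : ℂ) (ρ : ℝ), t ≠ 0 → Liouville ρ → ¬ LiouvilleOrder 49 ρ → SB 2 ![t, (ρ : ℂ) * t]) :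
    ∀ (t : ℂ) (ρ : ℝ), t ≠ 0 → Liouville ρ → ¬ LogHyperLiouville ρ → SB 2 ![t, (ρ : ℂ) * t] :=
  fun t ρ ht hρ hlog => hres t ρ ht hρ (logFloorResidual_sub_lowOrderResidual hlog)
/-- P6 — the kernel feeds the TREE class `LogPowMeasure` at EVERY exponential-algebraic point, e.g. at the dark scale `t_Ω` and at
logarithms of algebraic numbers (`t` transcendental with `e^t` algebraic ⇒ `(t, e^t)` dependent). -/
theorem probe_P6_logPow_tΩ (hNW : NesterenkoWaldschmidt1996_thm_1) : LogPowMeasure (![tΩ] : Fin 1 → ℂ) := logPowMeasure_tΩ hNW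
/-- P6′ — the kernel IN THE TREE CLASS with the g10 kernel's hypotheses VERBATIM (`logPowMeasure_of_dark`, frame G19 (1)), instantiated at the
FIXED POINTS of `exp` (relation `e^t − t = 0`, `K = 1`): the tree's `RootDecomp1KRadical05` family, there typed `FiniteTranscendenceType` with
`τ = 11` via Fel'dman's transference, here `LogPowMeasure` with `k = 2` read off the relation. -/
theorem probe_P6prime_kernel_at_fixed_point (hNW : NesterenkoWaldschmidt1996_thm_1) {t : ℂ} (ht : cexp t = t) : LogPowMeasure (![t] : Fin 1 → ℂ) := by
  have ht0 : t ≠ 0 := fun h => by rw [h, Complex.exp_zero] at ht; exact one_ne_zero ht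
  refine logPowMeasure_of_dark hNW ht0 Nat.one_pos ![-X, 1] (by simp) ?_
  simp [Fin.sum_univ_two, ht]
/-- P6″ — the dark scale `t_Ω` is outside every scale-keyed tree cell (hypothesis-free `tΩ_dark`) and the members' separations carry it. -/
theorem probe_P6dprime_tΩ_dark : Transcendental ℚ tΩ ∧ Transcendental ℚ (cexp tΩ) ∧ cexp tΩ ≠ tΩ ∧ ¬ AlgebraicIndependent ℚ ![tΩ, cexp tΩ] := tΩ_dark
/-- Probe read-back (§P; see the preceding docstring group). -/
theorem probe_P6dprime_member_separations : (Transcendental ℚ (zA 0) ∧ Transcendental ℚ (cexp (zA 0)) ∧ cexp (zA 0) ≠ zA 0 ∧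
    ¬ AlgebraicIndependent ℚ ![zA 0, cexp (zA 0)]) ∧ ¬ HyperLiouville ellT ∧ ¬ LiouvilleOrder 49 ellT := zA_separation
/-- P6‴ — F₊ ⊂ LogHyper as a typed inclusion (frame G19 (4)(C-c)): every positive integer exponential order gives a log-hyper ratio. -/
theorem probe_P6tprime_posLayer_sub_logHyper {k : ℕ} (hk : 1 ≤ k) {ρ : ℝ} (hρ : LiouvilleOrder k ρ) : LogHyperLiouville ρ := logHyperLiouville_of_liouvilleOrder hk hρ
/-- P7 — the TREE order-49 cell `sb_two_of_ordRatio` is an INSTANCE of the new cell (order 49 ⇒ order 1 ⇒ log-hyper). -/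
theorem probe_P7_ordRatio_instance (hNW : NesterenkoWaldschmidt1996_thm_1) {z : Fin 2 → ℂ} (hz : LinearIndependent ℚ z) {ρ : ℝ}
    (hρ : LiouvilleOrder 49 ρ) (h1 : z 1 = (ρ : ℂ) * z 0) : SB 2 z :=
  sb_two_of_logHyperRatio hNW hz (logHyperLiouville_of_liouvilleOrder (by norm_num) hρ) h1

end Probe

end Summit.Schanuel.Schanuel.Theorems.RootDecomp1KDarkLogSq
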